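import Mathlib.CategoryTheory.SingleObj
import Mathlib.Algebra.Group.PUnit
import Mathlib.Data.Nat.Prime.Infinite
import Mathlib.Data.Set.Finite.Basic
import Literature.AlgebraicGeometry.Frobenioids.DivisorMonoidCategoryTheoreticityDefs
import Literature.AlgebraicGeometry.Frobenioids.CategoriesFactorization
import HarnessLib

/-!
# Frobenioids I, Theorem 4.2 (i): the universal closure of the INTERFACE-typed `Thm42i S₁ S₂ Ψ` is
# false (junk operations); the instance form over Frobenioids is the named fact `FrdI.Thm42i`

Mochizuki, *The geometry of Frobenioids I: the general theory*, Kyushu J. Math. **62** (2008)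
293–400, §4, Theorem 4.2 (i) p. 77 [cite: MochizukiFrdI2008, Thm. 4.2 (i) p.77].

PROOF-ONLY companion (cell abc-iut, block F fact-proving wave, seat abc-iut-f-035; FACT-LIST row
F-1053 `PreFrobenioidData.Thm42i`) of `DivisorMonoidCategoryTheoreticityDefs.lean` (seat abc-iut-L1-t3).
There Thm. 4.2 (i) is typed as a predicate on two RAW operation packages `S₁ : PreFrobenioidData C₁ D₁`,
`S₂ : PreFrobenioidData C₂ D₂` (an INTERFACE, "TODO-merge") and an equivalence `Ψ : C₁ ≌ C₂` that is
NOT required to be compatible with `S₁`, `S₂` in any way. This file shows that the universal closure of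
that schema is false, by junk built from honest material: on the one-object category `C := SingleObj 𝔽`
of the standard Frobenioid monoid `𝔽 = F_{ℤ_{≥0}}` (Def. 1.1 (iii); `(z₁, d₁) · (z₂, d₂) =
(z₁ + d₁ z₂, d₁ d₂)`) over `D := SingleObj PUnit` take `S₁ :=` the honest operations (`Div(z, d) = z`,
`deg_Fr(z, d) = d`, `Φ ≡ ℤ_{≥0}`) and `S₂ :=` the same with the zero divisor TWISTED by the cocycle
`d ↦ d - 1`: `Div'(z, d) = z + (d - 1)` (the laws of Remark 1.1.1 still hold); `Ψ := 𝟭`. Both packages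
are of standard and isotropic type and not of group-like type (`Thm42Setting`: the irreducible arrows
`(0, p)`, `p` prime, are pairwise non-isomorphic, so the object is not an anchor and there are no
iso-subanchors; isometric pre-steps are the identity), but the object is Div-Frobenius-trivial for `S₁`
(section `n ↦ (0, n)`) and not for `S₂` (for `Div'` no arrow of degree `2` is an isometry), so the
clause "`Ψ` preserves Div-Frobenius-trivial objects" of `Thm42i S₁ S₂ 𝟭` fails:

* `PreFrobenioidData.exists_junk_thm42Setting` — the junk pair with `Thm42Setting` and the failure;
* `PreFrobenioidData.not_forall_thm42i` — the universal closure (level `0`) of `Thm42i` is FALSE.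

The print-faithful instance form — `S_i := PreFrobenioidData.ofFunctor Φ_i F_i` for FROBENIOIDS
`F_i : C_i ⥤ F_{Φ_i}`, `Φ_i` perf-factorial — is the cell's 0-ary named fact `FrdI.Thm42i`
(`DivisorMonoidCategoryTheoreticityFacts.lean`, FACT-LIST F-0716), closed in the tree modulo
"`Ψ`, `Ψ⁻¹` preserve pre-steps" (`FrdI.T42.thm42i_ofFunctor_of_preservesPreSteps`, seat abc-iut-w4-d105)
and at perfect type from the printed hypotheses alone (`thm42i_of_perfectType_asPrinted`, w4-d093).
Refuted-closure ≠ refuted-paper. No definitions; nothing here bears on [IUTchIII] Cor. 3.12.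
-/

namespace Literature.AlgebraicGeometry.Frobenioids

open CategoryTheory

namespace PreFrobenioidData

/-- **A junk pair for `Thm42Setting`.** On `C := SingleObj 𝔽` (`𝔽` the standard Frobenioid monoid)
over `D := SingleObj PUnit` with `Φ ≡ ℤ_{≥0}`: the honest operations `S₁` (`Div = z`, `deg_Fr = d`)
and the twisted operations `S₂` (`Div' = z + (d - 1)`, `deg_Fr = d`) are both of standard and isotropic
type and not of group-like type; the object is Div-Frobenius-trivial for `S₁` but not for `S₂`.
[cite: MochizukiFrdI2008, Thm. 4.2 p.77] -/
theorem exists_junk_thm42Setting :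
    ∃ (S₁ S₂ : PreFrobenioidData.{0} (SingleObj StandardFrobenioid) (SingleObj PUnit.{1})),
      Thm42Setting S₁ S₂ ∧ S₁.IsDivFrobeniusTrivial (SingleObj.star StandardFrobenioid) ∧
        ¬ S₂.IsDivFrobeniusTrivial (SingleObj.star StandardFrobenioid) := by
  let bs : SingleObj StandardFrobenioid ⥤ SingleObj PUnit.{1} :=
    MonoidHom.toFunctor (1 : StandardFrobenioid →* PUnit)
  let S₁ : PreFrobenioidData.{0} (SingleObj StandardFrobenioid) (SingleObj PUnit.{1}) :=
    { base := bs
      Mon := fun _ => Multiplicative ℕ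
      pull := fun _ => MonoidHom.id _
      pull_id := fun _ _ => rfl
      pull_comp := fun _ _ _ => rfl
      div := fun φ => (show StandardFrobenioid from φ).div
      degFr := fun φ => (show StandardFrobenioid from φ).degFr
      div_id := fun _ => rfl
      div_comp := fun _ _ => rfl
      degFr_id := fun _ => rfl
      degFr_comp := fun ψ φ => mul_comm (show StandardFrobenioid from φ).degFr _ }
  let S₂ : PreFrobenioidData.{0} (SingleObj StandardFrobenioid) (SingleObj PUnit.{1}) :=
    { base := bs
      Mon := fun _ => Multiplicative ℕ
      pull := fun _ => MonoidHom.id _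
      pull_id := fun _ _ => rfl
      pull_comp := fun _ _ _ => rfl
      div := fun φ => (show StandardFrobenioid from φ).div *
        Multiplicative.ofAdd (((show StandardFrobenioid from φ).degFr : ℕ) - 1)
      degFr := fun φ => (show StandardFrobenioid from φ).degFr
      div_id := fun _ => rfl
      div_comp := by
        intro A B B' ψ φ
        -- `Div'(ψ ≫ φ) = Div'(φ) · Div'(ψ)^{deg φ}`: the cocycle identity `d₁d₂ - 1 = (d₁ - 1) + d₁ (d₂ - 1)`
        change (show StandardFrobenioid from φ).div * (show StandardFrobenioid from ψ).div ^
              ((show StandardFrobenioid from φ).degFr : ℕ) *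
            Multiplicative.ofAdd ((((show StandardFrobenioid from φ).degFr *
              (show StandardFrobenioid from ψ).degFr : ℕ+) : ℕ) - 1) =
          (show StandardFrobenioid from φ).div *
              Multiplicative.ofAdd (((show StandardFrobenioid from φ).degFr : ℕ) - 1) *
            ((show StandardFrobenioid from ψ).div *
              Multiplicative.ofAdd (((show StandardFrobenioid from ψ).degFr : ℕ) - 1)) ^
              ((show StandardFrobenioid from φ).degFr : ℕ)
        generalize (show StandardFrobenioid from φ).div = a
        generalize (show StandardFrobenioid from ψ).div = b
        generalize (show StandardFrobenioid from φ).degFr = d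
        generalize (show StandardFrobenioid from ψ).degFr = e
        apply Multiplicative.toAdd.injective
        simp only [toAdd_mul, toAdd_pow, toAdd_ofAdd, smul_eq_mul, PNat.mul_coe]
        obtain ⟨d', rfl⟩ : ∃ d' : ℕ, d = ⟨d' + 1, d'.succ_pos⟩ :=
          ⟨(d : ℕ) - 1, PNat.eq (by simp [Nat.sub_add_cancel d.pos])⟩
        obtain ⟨e', rfl⟩ : ∃ e' : ℕ, e = ⟨e' + 1, e'.succ_pos⟩ :=
          ⟨(e : ℕ) - 1, PNat.eq (by simp [Nat.sub_add_cancel e.pos])⟩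
        simp only [PNat.mk_coe, Nat.add_sub_cancel]
        have : (d' + 1) * (e' + 1) - 1 = d' * e' + d' + e' := by
          rw [show (d' + 1) * (e' + 1) = d' * e' + d' + e' + 1 by ring, Nat.add_sub_cancel]
        rw [this]
        ring
      degFr_id := fun _ => rfl
      degFr_comp := fun ψ φ => mul_comm (show StandardFrobenioid from φ).degFr _ }
  /- (1) Category-level facts about `C = SingleObj 𝔽`, phrased through the honest operations `S₁`. -/
  -- an arrow with `deg_Fr = 1` and `Div = 0` is the identity, hence an isomorphism
  have hiso : ∀ {X Y : SingleObj StandardFrobenioid} (β : X ⟶ Y),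
      S₁.degFr β = 1 → S₁.div β = 1 → IsIso β := by
    intro X Y β hdeg hdiv
    have e : β = 𝟙 X := ElemFrobenioidMonoid.ext hdiv hdeg
    subst e
    exact ⟨⟨𝟙 X, Category.id_comp _, (Category.comp_id _).trans rfl⟩⟩
  -- an isomorphism has `deg_Fr = 1`
  have hdeg_of_iso : ∀ {X Y : SingleObj StandardFrobenioid} (r : X ⟶ Y), IsIso r → S₁.degFr r = 1 := by
    intro X Y r hr
    have h := S₁.degFr_comp r (inv r)
    rw [IsIso.hom_inv_id, S₁.degFr_id] at h
    have h' := congrArg PNat.val h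
    rw [PNat.mul_coe, PNat.one_coe] at h'
    exact PNat.coe_eq_one_iff.mp (Nat.eq_one_of_mul_eq_one_right h'.symm)
  -- no object is an anchor: the irreducible arrows `(0, p)`, `p` prime, are pairwise non-isomorphic
  have hanchor : ∀ A : SingleObj StandardFrobenioid, ¬ IsAnchor A := by
    intro A hfin
    let φ : {p : ℕ // p.Prime} → (A ⟶ A) := fun p =>
      show A ⟶ A from (⟨1, ⟨p.1, p.2.pos⟩⟩ : StandardFrobenioid)
    have hφdeg : ∀ p, (S₁.degFr (φ p) : ℕ) = p.1 := fun p => rfl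
    have hirr : ∀ p, IsIrreducibleHom (φ p) := by
      intro p
      refine ⟨fun h => p.2.one_lt.ne' ?_, fun X β α hβα => ?_⟩
      · rw [← hφdeg p, hdeg_of_iso (φ p) h, PNat.one_coe]
      · -- degrees: `deg β · deg α = p`; divisors: `Div α + deg α · Div β = 0`
        have hd := S₁.degFr_comp β α
        rw [hβα] at hd
        have hd' : (S₁.degFr β : ℕ) * S₁.degFr α = p.1 := by
          rw [← hφdeg p, hd, PNat.mul_coe]
        have hv := S₁.div_comp β α
        rw [hβα] at hv
        have hv' : (1 : Multiplicative ℕ) = S₁.div α * S₁.div β ^ (S₁.degFr α : ℕ) := hv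
        have hvA : Multiplicative.toAdd (α := ℕ) (S₁.div α) +
            (S₁.degFr α : ℕ) * Multiplicative.toAdd (α := ℕ) (S₁.div β) = 0 := by
          have h' := congrArg (Multiplicative.toAdd (α := ℕ)) hv'
          simp only [toAdd_one] at h'
          exact h'.symm
        have hα0 : Multiplicative.toAdd (α := ℕ) (S₁.div α) = 0 := Nat.eq_zero_of_add_eq_zero_right hvA
        have hβ0 : Multiplicative.toAdd (α := ℕ) (S₁.div β) = 0 :=
          (Nat.mul_eq_zero.mp (Nat.eq_zero_of_add_eq_zero_left hvA)).resolve_left (PNat.ne_zero _)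
        have hα1 : S₁.div α = 1 := by
          rw [← ofAdd_toAdd (α := ℕ) (S₁.div α), hα0]; rfl
        have hβ1 : S₁.div β = 1 := by
          rw [← ofAdd_toAdd (α := ℕ) (S₁.div β), hβ0]; rfl
        rcases (Nat.dvd_prime p.2).mp (Dvd.intro _ hd') with h1 | hp
        · exact Or.inr (hiso β (PNat.coe_eq_one_iff.mp h1) hβ1)
        · refine Or.inl (hiso α (PNat.coe_eq_one_iff.mp ?_) hα1)
          have : (S₁.degFr β : ℕ) * S₁.degFr α = (S₁.degFr β : ℕ) * 1 := by rw [hd', mul_one, hp]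
          exact Nat.eq_of_mul_eq_mul_left (PNat.pos _) this
    haveI : Infinite {p : ℕ // p.Prime} := Nat.infinite_setOf_prime.to_subtype
    refine Set.infinite_of_injective_forall_mem
      (s := {x : Quotient (isIsomorphicSetoid (Under A)) |
        ∃ f : Under A, IsIrreducibleHom f.hom ∧ Quotient.mk _ f = x})
      (f := fun p => Quotient.mk _ (Under.mk (φ p))) ?_ (fun p => ⟨Under.mk (φ p), hirr p, rfl⟩) hfin
    intro p q hpq
    obtain ⟨e⟩ := Quotient.exact hpq
    have hw : φ p ≫ (Under.forget A).map e.hom = φ q := Under.w e.hom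
    have hr : S₁.degFr ((Under.forget A).map e.hom) = 1 := hdeg_of_iso _ inferInstance
    have hd := S₁.degFr_comp (φ p) ((Under.forget A).map e.hom)
    rw [hw, hr, mul_one] at hd
    have hd' := congrArg PNat.val hd
    rw [hφdeg, hφdeg] at hd'
    exact Subtype.ext hd'.symm
  -- powers in `End A` are powers in `𝔽`
  have hpow : ∀ (A : SingleObj StandardFrobenioid) (α : End A) (k : ℕ),
      (α ^ k : End A) = (show StandardFrobenioid from α) ^ k := by
    intro A α k
    induction k with
    | zero => rfl
    | succ k ih =>
      conv_lhs => rw [pow_succ, ih]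
      exact (pow_succ (show StandardFrobenioid from α) k).symm
  have hpow' : ∀ (a : Multiplicative ℕ) (k : ℕ),
      ((⟨a, 1⟩ : StandardFrobenioid) ^ k) = ⟨a ^ k, 1⟩ := by
    intro a k
    induction k with
    | zero => ext <;> simp
    | succ k ih =>
      rw [pow_succ, ih]
      ext
      · simp [pow_succ]
      · simp
  /- (2) The generic part: operations on `SingleObj 𝔽` over `SingleObj PUnit` with `deg_Fr = d`, all
  base maps invertible, whose isometric pre-steps are isomorphisms, which are not of group-like type and
  are non-dilating, are of standard and isotropic type. -/
  have generic : ∀ (S : PreFrobenioidData.{0} (SingleObj StandardFrobenioid) (SingleObj PUnit.{1})),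
      (∀ {X Y : SingleObj StandardFrobenioid} (φ : X ⟶ Y),
        S.degFr φ = (show StandardFrobenioid from φ).degFr) →
      (∀ {X Y : SingleObj StandardFrobenioid} (φ : X ⟶ Y), S.IsBaseIso φ) →
      (∀ {X Y : SingleObj StandardFrobenioid} (β : X ⟶ Y), S.IsIsometricPreStep β → IsIso β) →
      ¬ S.IsOfGroupLikeType → S.IsNonDilatingOn → S.IsOfStandardType ∧ S.IsOfIsotropicType := by
    intro S hdeg hbase hkey hng hnd
    have hisoA : ∀ A, S.IsIsotropic A := fun A B φ h => hkey φ h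
    have hco : ∀ {X Y : SingleObj StandardFrobenioid} (φ : X ⟶ Y), S.IsCoAngular φ :=
      fun φ X' Y' γ β α _ _ hβ _ => hkey β hβ
    refine ⟨⟨⟨fun A => ⟨fun h => (h (hisoA A)).elim, fun h => ?_⟩⟩, ⟨fun A => ?_⟩,
      fun h => (hng h).elim, ⟨fun A => ?_⟩, ?_, hnd⟩, ⟨hisoA⟩⟩
    · -- no iso-subanchors
      obtain ⟨B, G, f, ⟨B', hB', _⟩, _⟩ := h
      exact (hanchor B' hB').elim
    · -- Frobenius-isotropic: the identity is of Frobenius type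
      exact ⟨A, 𝟙 A, ⟨⟨hco _, S.div_id A⟩, hbase _⟩, hisoA A⟩
    · -- Frobenius-normalized: `α^d ∘ φ = φ ∘ α` for `α = (a, 1)`, `φ = (z, d)`
      intro φ _ α hα
      obtain ⟨a, m⟩ := α
      obtain ⟨z, d⟩ := φ
      have hm : m = 1 := (hdeg _).symm.trans hα.2
      subst hm
      rw [hdeg, hpow A]
      change (HMul.hMul (α := StandardFrobenioid) (β := StandardFrobenioid)
          ((⟨a, 1⟩ : StandardFrobenioid) ^ (d : ℕ)) ⟨z, d⟩) =
        HMul.hMul (α := StandardFrobenioid) (β := StandardFrobenioid) (⟨z, d⟩ : StandardFrobenioid) ⟨a, 1⟩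
      rw [hpow']
      ext
      · simp [mul_comm]
      · simp
    · -- `D = SingleObj PUnit` is of FSM-, hence FSMFF-type
      exact (IsOfFSMType.mk fun f _ => inferInstance : IsOfFSMType (SingleObj PUnit.{1})).isOfFSMFFType
  /- (3) The hypotheses of `generic` for `S₁` and `S₂`. -/
  have hbase : ∀ {X Y : SingleObj StandardFrobenioid} (φ : X ⟶ Y), IsIso (bs.map φ) :=
    fun φ => inferInstance
  have hnd : ∀ (S : PreFrobenioidData.{0} (SingleObj StandardFrobenioid) (SingleObj PUnit.{1})),
      (∀ {X Y : SingleObj PUnit.{1}} (f : Y ⟶ X), S.pull f = MonoidHom.id _) → S.IsNonDilatingOn := by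
    intro S hpull
    refine ⟨fun X f => ?_⟩
    rw [hpull]
    intro _ a
    induction a using Quotient.inductionOn with
    | h x => rfl
  have hng : ∀ (S : PreFrobenioidData.{0} (SingleObj StandardFrobenioid) (SingleObj PUnit.{1}))
      (x : S.Mon (S.base.obj (SingleObj.star StandardFrobenioid))), x ≠ 1 → ¬ S.IsOfGroupLikeType :=
    fun S x hx h => hx (h.obj _ x)
  have hone : Multiplicative.ofAdd (α := ℕ) 1 ≠ (1 : Multiplicative ℕ) :=
    fun h => absurd (congrArg (Multiplicative.toAdd (α := ℕ)) h) (by simp)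
  have hkey₁ : ∀ {X Y : SingleObj StandardFrobenioid} (β : X ⟶ Y), S₁.IsIsometricPreStep β → IsIso β :=
    fun β h => hiso β h.1.1 h.2
  have hkey₂ : ∀ {X Y : SingleObj StandardFrobenioid} (β : X ⟶ Y), S₂.IsIsometricPreStep β → IsIso β := by
    intro X Y β h
    have h1 : S₁.degFr β = 1 := h.1.1
    have h2 : S₁.div β * Multiplicative.ofAdd (α := ℕ) ((S₁.degFr β : ℕ) - 1) = 1 := h.2
    rw [h1] at h2
    have h3 : S₁.div β * Multiplicative.ofAdd (α := ℕ) 0 = 1 := h2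
    rw [ofAdd_zero, mul_one] at h3
    exact hiso β h1 h3
  obtain ⟨hst₁, his₁⟩ := generic S₁ (fun _ => rfl) hbase hkey₁ (hng S₁ _ hone) (hnd S₁ fun _ => rfl)
  obtain ⟨hst₂, his₂⟩ := generic S₂ (fun _ => rfl) hbase hkey₂ (hng S₂ _ hone) (hnd S₂ fun _ => rfl)
  refine ⟨S₁, S₂, ⟨⟨hst₁, hst₂⟩, ⟨his₁, his₂⟩, ⟨hng S₁ _ hone, hng S₂ _ hone⟩⟩, ?_, ?_⟩
  · -- the object is Div-Frobenius-trivial for `S₁`: the section `n ↦ (0, n)`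
    refine ⟨(SingleObj.toEnd StandardFrobenioid).toMonoidHom.comp StandardFrobenioid.degSection,
      fun n => ⟨rfl, fun _ => rfl, ⟨?_, rfl⟩, hbase _⟩⟩
    exact fun X' Y' γ β α _ _ hβ _ => hkey₁ β hβ
  · -- … but not for `S₂`: a Frobenius-type arrow of degree `2` would have `Div' = z + 1 = 0`
    rintro ⟨ζ, hζ⟩
    obtain ⟨h2, -, ⟨⟨-, hisom⟩, -⟩⟩ := hζ 2
    have h2' : S₁.degFr (ζ 2) = 2 := h2
    have hisom' : S₁.div (ζ 2) * Multiplicative.ofAdd (α := ℕ) ((S₁.degFr (ζ 2) : ℕ) - 1) = 1 := hisom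
    rw [h2'] at hisom'
    have hisom'' : S₁.div (ζ 2) * Multiplicative.ofAdd (α := ℕ) 1 = (1 : Multiplicative ℕ) := hisom'
    have := congrArg (Multiplicative.toAdd (α := ℕ)) hisom''
    rw [toAdd_mul, toAdd_ofAdd, toAdd_one] at this
    omega

/-- **The universal closure of [FrdI] Thm. 4.2 (i) AS TYPED over the interface
(`PreFrobenioidData.Thm42i S₁ S₂ Ψ`, raw operation packages and an unrelated equivalence) is FALSE** (at
universe level `0`): for the junk pair of `exists_junk_thm42Setting` and `Ψ = 𝟭`, `Thm42Setting` holds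
but "`Ψ` preserves Div-Frobenius-trivial objects" fails. The print-faithful instance form (Frobenioids,
`ofFunctor`) is the named fact `FrdI.Thm42i` (F-0716). [cite: MochizukiFrdI2008, Thm. 4.2 (i) p.77] -/
theorem not_forall_thm42i :
    ¬ ∀ (C₁ : Type) [Category.{0} C₁] (D₁ : Type) [Category.{0} D₁] (C₂ : Type) [Category.{0} C₂]
        (D₂ : Type) [Category.{0} D₂] (S₁ : PreFrobenioidData.{0} C₁ D₁) (S₂ : PreFrobenioidData.{0} C₂ D₂)
        (Ψ : C₁ ≌ C₂), Thm42i S₁ S₂ Ψ := by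
  intro h
  obtain ⟨S₁, S₂, hT, h₁, h₂⟩ := exists_junk_thm42Setting
  exact h₂ ((h _ _ _ _ S₁ S₂ CategoryTheory.Equivalence.refl hT).2.2.1 h₁)

end PreFrobenioidData

end Literature.AlgebraicGeometry.Frobenioids
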